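import Summits.QuantumFields.QCD.Theses.HeatSlicedQuarks
import Summits.QuantumFields.QCD.Theses.GradientFlowSpecies
import Summits.QuantumFields.QCD.Theorems.GluonicCompletion.Negative.Threshold
import Summits.QuantumFields.QCD.Theorems.RobustYangMillsHandover.Negative.GapClauses

/-!
# Line `low-mode-quarantine` — checked skeleton for the crux
`Summit.QuantumFields.QCD.Theses.HeatSlicedQuarks.RobustYangMillsHandover` (stmt-QuantumFields-8892)

Planner crux-plan, round 1 (gen 1).  Idea card `Cruxes/RobustYangMillsHandover/Ideas/low-mode-quarantine.md`
(ideator 2), triage `TRIAGE-r1-{1,2,3}.md` (3 × pass; sharpenings honoured below), standing disproof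
`Cruxes/RobustYangMillsHandover/Disproof.lean` (cycles 1–2, §§1–11; landed negatives
`Theorems/RobustYangMillsHandover/Negative/{WithoutNontriviality,GapClauses,SchemeAsymptotics,FreeWilsonModes}.lean`),
`FINDINGS-g2k1.md` (B1–B4 + dead ends), the neighbouring gen-2 card `Ideas/band-limited-payload.md`, the
standing disproof of the budget crux `Cruxes/ActionBoundsLowModes/Disproof.lean` (8872: fixed `m₀ < 0` is the
safe regime) and the common head `Lines/existence-pays-the-continuum-half.lean`.
Line card: `Cruxes/RobustYangMillsHandover/Lines/low-mode-quarantine.md`.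

## The crux and the line in one paragraph

The crux is the bare arrow `RobustYangMillsHandover := ContinuumQCDExists → QCD` (X₀ → QCD).  By the common
head of every line on this crux (triage 1/2/3; `Lines/existence-pays-the-continuum-half.lean`, re-derived
sorry-free in §3 below over the LANDED `Negative.GapClauses` and `qcdOf_iff_threshold`) it suffices to supply
(a) the continuum-half engine `GradientFlowSpecies.GapTransfer` (stmt-8923, BY NAME: `stub_gapTransfer`) and
(b) the lattice-half residual `GradientFlowSpecies.MassiveLatticeGap` (stmt-8922: for every X₀-honest
regularisation, above a threshold, lattice QCD at the scheme's OWN `(β_k, m_crit(k) + a_k m_f/Z_m(k))` is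
gapped uniformly in the volume).  THIS LINE supplies (b) by the QUARANTINE MECHANISM of the card: at the
heavy-quark handover (block) scale, where `|m_eff| ≥ m₀ = O(1)` in block units, the terminal Berezin integral
`∫ dψ̄dψ e^{−ψ̄Dψ}(…)` FACTORISES EXACTLY across the singular-value cut `σ² = λ := m₀²/4` of the effective
Dirac operator `D` (algebraic core: `D` intertwines `DᴴD` and `DDᴴ`, §0 `intertwine_pow`; no cross terms
between different singular subspaces, §0 `cross_terms_vanish`); the LOW block is finite, local and tame —
empty on small fields (`stub_smoothFieldFloor`), exponentially localised on the rough plaquettes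
(`stub_lowModesHugRoughness`, the card's first lemma), of rank budgeted LOCALLY by the Wilson action of a
collar of its support (`stub_localModeBudget`, the local volume-free form of route crux 3 = 8872 that triage 1
and the gen-2 card asked for), with `|det D_low| ≤ λ^{N/2} ≤ 1` and adjugates `≤ λ^{(N−1)/2}` (Hadamard) —
i.e. a large-field factor of modulus `≤ 1` (floor `0` in the D1′ sense) carrying the whole `N_f = 3` /
split-mass SIGN; the HIGH block is coercive BY CONSTRUCTION (`σ² ≥ λ`) and its functional calculus at spectral
scale `λ` is quasi-local UNIFORMLY in the gauge field (`stub_highBlockLocality`: quadratic Combes–Thomas for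
`(DᴴD + λ)⁻¹` at rate `√λ`).  The handover theorem `stub_quarantinedDecoupling` turns these four typed
spectral facts into the TEMPERED lattice gap (`TemperedQuarantineGap`: every honest regularisation, every
ratio bound `Rm`, above a threshold `M₁(Rm)`): (positive, KP-controlled bulk) × (rare signed factors of
modulus `≤ 1` on large-field polymers) ⇒ volume-uniform lattice gap — it CONTAINS the Yang–Mills-strength
input every line on this crux needs (β-universal, expansion-format robust `SU(3)` lattice Yang–Mills at an
asymptotically free block scale: FINDINGS B1/B2, triage cross-notes 2–3) and is the HARDEST stub; the
HIERARCHICAL corner (some mass ratio `> Rm`, where decoupling raises the effective scale and the lighter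
quarks are light — a finding of the sibling seat geometric-mean-handover, shared verbatim as
`stub_lightRemnantLatticeGap`) is NOT the quarantine's business; tempered ∨ hierarchical = 8922 by pure
logic (§3).

Registered stubs (the only `sorry`s; 2–5 are stated in UNFOLDED tree vocabulary so that their proofs land
verbatim as `Theorems/` files; 6–7 use the packaged names of §1, definitionally the same texts):

* `stub_gapTransfer`           : `GradientFlowSpecies.GapTransfer` (8923 by name)             — M–L, shared head
* `stub_smoothFieldFloor`       : no sub-threshold modes on `ε₀(m₀)`-smooth fields              — M
* `stub_lowModesHugRoughness`   : Agmon localisation of sub-threshold eigenmodes on roughness   — L (first lemma)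
* `stub_localModeBudget`        : local, volume-free CLR below threshold (Dirichlet form)       — L
* `stub_highBlockLocality`      : `U`-uniform quadratic Combes–Thomas for `(DᴴD + λ)⁻¹`          — M
* `stub_quarantinedDecoupling`  : the four spectral facts ⇒ `TemperedQuarantineGap`            — open/XL, HARDEST
* `stub_lightRemnantLatticeGap` : hierarchical tuples (shared verbatim with geometric-mean-handover) — open, not this mechanism

and the kernel-checked composition `RobustYangMillsHandover_of` (sorry-free; concludes the route decl BY NAME;
§3 also derives `GradientFlowSpecies.MassiveLatticeGap` 8922 by name from stubs 2–7).

## Disproof.lean, honoured (cited by section)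

* §1 `not_handover_iff`, `handover_iff_target_iff_qcd` (landed `Negative.not_handover_iff`): X₀'s truth value
  is never used; the line proves the two gap clauses for X₀'s OWN witnesses (same-regularisation proof, §6).
* §2 `handoverWithoutNontriviality_iff_qcd` — THE load-bearing obstruction ("a proof must USE the
  non-triviality of the handed-over `T`"): honoured at `stub_quarantinedDecoupling`, whose target 8922 carries
  the three non-triviality clauses in its hypothesis (`IsNontrivial glue`, `IsNonGaussian glue`,
  `IsNontrivial (pseudoRe f g)`): they pin `m_crit(k), Z_m(k)` honest (the junk `canonicalAF`, `z = 0` witness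
  of `continuumQCDExistsWithoutNontriviality_holds` is outside the class), which is exactly the regime where
  quarks are light at the cutoff, supercritical in bare mass, and the quarantine has work to do.
* §5/§8 `handover_of_aboveThreshold`, `continuumQCDExists_iff_threshold`: only the heavy regime above a
  `reg`-dependent threshold is owed (`∀ reg ∃ M`, weaker than §5's `∃ M₀ ∀ reg`); `qcdOf_iff_threshold` absorbs it (§3).
* §6 `sameReg_iff`, `hasLatticeMassGap_scheme_indep`, `hasLatticeMassGap_anti` (landed, IMPORTED here):
  stub 6 is §6's `SameRegLatticeGap` above a threshold; stub 1 discharges `SameRegContinuumGap` from it.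
* §9(ii) `scheme_mq_eventually_neg(_of_logBound)` + §10 `numericalRange_neg_of_mass_neg` (landed
  `Negative/SchemeAsymptotics`, `Negative/FreeWilsonModes`): THE RAISON D'ÊTRE of this line — no accretivity /
  coercivity of any TUNED operator is claimed anywhere; the fine bare mass is eventually negative, the
  quarantine lives at the BLOCK scale (`|m_eff| ≥ m₀` in block units; the typed stubs are the `wilsonDirac`
  model case in the route's window `m ∈ [−1/2, 1]`, `|m| ≥ m₀`, exactly as the card's first lemma), and the
  low block is QUARANTINED, not assumed away.  FINDINGS dead end "terminal quarantine at the FINE lattice"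
  (Weyl slack `λ²L⁴` extensive, bare floor `(a m/Z_m)² → 0`) is avoided for the same reason: no Weyl term
  (threshold below the free gap), budget LOCAL, scale = block.
* §9(i) `quarkLoopShift_tendsto_atTop`: the marginal heavy-quark effect is the divergent coupling shift
  absorbed by β-matching (`CouplingMatching` 8797), so the YM content of stub 6 must be β-UNIVERSAL along
  matched a.f. sequences (8796-type; FINDINGS B2: necessary for every line) — stated in its docstring.
* §11 (robust-gap theorems need structure; fundamental–adjoint critical endpoint): the bulk perturbation the
  quarantine hands over is two-sided SMALL only after the free-threshold × irrelevance squeeze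
  (card threshold-irrelevance-squeeze), i.e. within any coupling-relative radius — recorded in stub 6.
* `-- Targets`: none at plan time (no line picked; `stuck_stubs = []`).  Landed `Negative/` lemmas of THIS crux
  are iff/asymptotics facts and refute no instance of any stub; the budget crux's landed
  `ActionBoundsLowModes.Negative.LoadBearing` (`…_false_without_one` at `m = 0, λ = 0`;
  `…_false_without_weyl` at `λ = 81`) does not touch `stub_localModeBudget` (`|m| ≥ m₀ > 0`, threshold
  `m₀²/4 <` free gap `m₀²`, and the `+1` is kept).
* Negatives index (`ledger negatives --problem QuantumFields`: 9665, 9603, 9494, 9599): none is an instance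
  or weakening of a stub; 9494 (U-uniform Riesz frame of smooth collar-local generators) is the contrast
  class — the quarantine posits no frame, no smoothness, no conditioning (triage 2/3 ✓).

Everything non-Mathlib is referred to by tree names under the `open`s below; stubs 2–5 contain no
skeleton-local name.
-/

noncomputable section

namespace Summit.QuantumFields.QCD.Cruxes.RobustYangMillsHandover.LowModeQuarantine

open scoped BigOperators Classical Matrix
open Summit.QuantumFields.QCD.Theses.HeatSlicedQuarks (ContinuumQCDExists RobustYangMillsHandover)
open Summit.QuantumFields.QCD.Theorems.GluonicCompletion.Negative (qcdOf_iff_threshold)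
open Summit.QuantumFields.QCD.Theorems.RobustYangMillsHandover.Negative
  (hasLatticeMassGap_scheme_indep hasLatticeMassGap_anti)
open Literature.MathematicalPhysics.QuantumFieldTheory
open Literature.MathematicalPhysics.QuantumLattice
open Literature.Probability.LatticeModels (TorusSite)
open Filter Topology

/-! ## §0 The algebraic core of the exact singular-value factorisation (sorry-free, NOT stubs)

For ANY square complex matrix `D`: `D` intertwines the powers of `H = DᴴD` and `H̃ = DDᴴ`
(`intertwine_pow`, hence every polynomial / entire cut-off built from the route's own semigroup is carried
across the singular-value decomposition), and the bilinear form `w̄ D v` has NO CROSS TERMS between an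
eigenvector `v` of `H` and an eigenvector `w` of `H̃` with different eigenvalues (`cross_terms_vanish`).
In generators adapted to (low singular modes `σ² ≤ λ`) ⊕ (high) the Berezin integral therefore factorises
exactly: `∫dψ̄dψ e^{−ψ̄Dψ}(…) = [phase] · (finite N×N quarantined integral) · (coercive Gaussian integral)`
(card Lever; triage 1/3 re-checked).  These are the card's `HeatKernelIntertwining` /
`SingularCrossTermsVanish`, S-sized, proved here so that no stub is bookkeeping. -/

section Algebra

variable {ι : Type*} [Fintype ι] [DecidableEq ι]

/-- `D (DᴴD)ⁿ = (DDᴴ)ⁿ D` for every square matrix `D` and every `n`. [folklore] -/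
theorem intertwine_pow (D : Matrix ι ι ℂ) (n : ℕ) : D * (Dᴴ * D) ^ n = (D * Dᴴ) ^ n * D := by
  induction n with
  | zero => simp
  | succ n ih =>
    calc D * (Dᴴ * D) ^ (n + 1) = (D * (Dᴴ * D) ^ n) * (Dᴴ * D) := by rw [pow_succ, Matrix.mul_assoc]
      _ = (D * Dᴴ) ^ n * D * (Dᴴ * D) := by rw [ih]
      _ = (D * Dᴴ) ^ n * (D * Dᴴ) * D := by simp only [Matrix.mul_assoc]
      _ = (D * Dᴴ) ^ (n + 1) * D := by rw [← pow_succ]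

/-- Polynomial functional calculus is carried across: `D · p(DᴴD) = p(DDᴴ) · D` for every finite linear
combination of powers (e.g. truncated heat semigroups / Chebyshev cut-offs). [folklore] -/
theorem intertwine_sum (D : Matrix ι ι ℂ) (s : Finset ℕ) (c : ℕ → ℂ) :
    D * (∑ n ∈ s, c n • (Dᴴ * D) ^ n) = (∑ n ∈ s, c n • (D * Dᴴ) ^ n) * D := by
  rw [Finset.mul_sum, Finset.sum_mul]
  refine Finset.sum_congr rfl fun n _ => ?_
  rw [Matrix.mul_smul, Matrix.smul_mul, intertwine_pow]

omit [DecidableEq ι] in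
/-- **No cross terms.** If `(DᴴD) v = μ v` and `(DDᴴ) w = ν w` with real `μ ≠ ν`, then `w̄ · (D v) = 0`:
the quadratic form `ψ̄Dψ` is block-diagonal in generators adapted to the singular subspaces. [folklore] -/
theorem cross_terms_vanish (D : Matrix ι ι ℂ) (v w : ι → ℂ) (μ ν : ℝ)
    (hv : (Dᴴ * D) *ᵥ v = (μ : ℂ) • v) (hw : (D * Dᴴ) *ᵥ w = (ν : ℂ) • w) (hne : μ ≠ ν) :
    star w ⬝ᵥ (D *ᵥ v) = 0 := by
  -- compute `star w ⬝ᵥ (D DᴴD v)` in two ways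
  have h1 : star w ⬝ᵥ ((D * (Dᴴ * D)) *ᵥ v) = (μ : ℂ) * (star w ⬝ᵥ (D *ᵥ v)) := by
    rw [← Matrix.mulVec_mulVec, hv, Matrix.mulVec_smul, dotProduct_smul, smul_eq_mul]
  have h2 : star w ⬝ᵥ ((D * (Dᴴ * D)) *ᵥ v) = (ν : ℂ) * (star w ⬝ᵥ (D *ᵥ v)) := by
    have hassoc : D * (Dᴴ * D) = (D * Dᴴ) * D := (Matrix.mul_assoc _ _ _).symm
    rw [hassoc, ← Matrix.mulVec_mulVec, Matrix.dotProduct_mulVec]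
    -- `star w ᵥ* (D Dᴴ) = star ((D Dᴴ)ᴴ *ᵥ w) = star ((D Dᴴ) *ᵥ w) = star (ν • w) = ν • star w`
    have hH : (D * Dᴴ)ᴴ = D * Dᴴ := by rw [Matrix.conjTranspose_mul, Matrix.conjTranspose_conjTranspose]
    have hvm : star w ᵥ* (D * Dᴴ) = (ν : ℂ) • star w := by
      conv_lhs => rw [← hH]
      rw [← Matrix.star_mulVec, hw, star_smul, ← starRingEnd_apply, Complex.conj_ofReal]
    rw [hvm, smul_dotProduct, smul_eq_mul]
  have h3 : ((μ : ℂ) - ν) * (star w ⬝ᵥ (D *ᵥ v)) = 0 := by rw [sub_mul, ← h1, ← h2, sub_self]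
  rcases mul_eq_zero.mp h3 with h | h
  · exact absurd (by exact_mod_cast sub_eq_zero.mp h) hne
  · exact h

end Algebra

/-! ## §1 Packaged vocabulary (definitions only; stubs 2–5 restate these texts UNFOLDED) -/

local notation "SU3" => Matrix.specialUnitaryGroup (Fin 3) ℂ
local notation "ρ₃" => fundamentalRep (Fin 3)

/-- **Smooth-field spectral floor** (no quarantine on small fields — triage 3's mandatory sharpening): for
every `m₀ ∈ (0, 1]` there is `ε₀ = ε₀(m₀) > 0` such that for every torus, every `SU(3)` field ALL of whose
plaquettes have deficit `3 − Re tr U_p ≤ ε₀`, and every bare mass in the route's window `m ∈ [−1/2, 1]` with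
`|m| ≥ m₀`, the Wilson–Dirac operator has singular values `≥ m₀/√2`: `‖D_W v‖² ≥ (m₀²/2)‖v‖²`. -/
def SmoothFieldFloor : Prop :=
  ∀ m₀ : ℝ, 0 < m₀ → m₀ ≤ 1 → ∃ ε₀ : ℝ, 0 < ε₀ ∧
    ∀ (L : ℕ) [NeZero L] (U : GaugeConfig 4 L SU3) (m : ℝ), m ∈ Set.Icc (-(1 / 2 : ℝ)) 1 → m₀ ≤ |m| →
      (∀ (y : TorusSite 4 L) (μ ν : Fin 4), 3 - ((ρ₃ (plaquetteHolonomy U y μ ν)).trace).re ≤ ε₀) →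
        ∀ v : TorusSite 4 L × Fin 3 × Fin 4 → ℂ,
          m₀ ^ 2 / 2 * ∑ i, ‖v i‖ ^ 2 ≤ ∑ i, ‖(wilsonDirac ρ₃ U m 1).mulVec v i‖ ^ 2

/-- **Low modes hug the roughness** (the card's first lemma, lattice Agmon): sub-threshold eigenmodes of
`H_U = D_Wᴴ D_W` (eigenvalue `e ∈ [0, m₀²/4]`) are exponentially small at torus distance `n` from the set
of `ε₀`-rough plaquettes, with constants depending on `m₀` only. -/
def LowModesHugRoughness : Prop :=
  ∀ m₀ : ℝ, 0 < m₀ → m₀ ≤ 1 → ∃ ε₀ c C : ℝ, 0 < ε₀ ∧ 0 < c ∧ 0 < C ∧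
    ∀ (L : ℕ) [NeZero L] (U : GaugeConfig 4 L SU3) (m : ℝ), m ∈ Set.Icc (-(1 / 2 : ℝ)) 1 → m₀ ≤ |m| →
      ∀ (v : TorusSite 4 L × Fin 3 × Fin 4 → ℂ) (e : ℝ), 0 ≤ e → e ≤ m₀ ^ 2 / 4 →
        ((wilsonDirac ρ₃ U m 1)ᴴ * wilsonDirac ρ₃ U m 1).mulVec v = (e : ℂ) • v →
          ∀ (x : TorusSite 4 L) (n : ℕ),
            (∀ y : TorusSite 4 L, (∃ μ ν : Fin 4, ε₀ ≤ 3 - ((ρ₃ (plaquetteHolonomy U y μ ν)).trace).re) →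
              n ≤ torusDist x y) →
            ∑ a : Fin 3, ∑ α : Fin 4, ‖v (x, a, α)‖ ^ 2 ≤ C * Real.exp (-(c * n)) * ∑ i, ‖v i‖ ^ 2

/-- **Local mode budget** (local, volume-free form of route crux 3 `ActionBoundsLowModes` below the free
threshold; Dirichlet form): the number of independent quark fields SUPPORTED IN a site set `Z` with
`‖D_W v‖² ≤ (m₀²/4)‖v‖²` is at most `C(m₀) · (Wilson action of the plaquettes based within torus distance
`R(m₀)` of `Z` + 1)`. -/
def LocalModeBudget : Prop :=
  ∀ m₀ : ℝ, 0 < m₀ → m₀ ≤ 1 → ∃ (R : ℕ) (C : ℝ),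
    ∀ (L : ℕ) [NeZero L] (U : GaugeConfig 4 L SU3) (m : ℝ), m ∈ Set.Icc (-(1 / 2 : ℝ)) 1 → m₀ ≤ |m| →
      ∀ (Z : Finset (TorusSite 4 L)) (E : Submodule ℂ (TorusSite 4 L × Fin 3 × Fin 4 → ℂ)),
        (∀ v ∈ E, ∀ x ∉ Z, ∀ (a : Fin 3) (α : Fin 4), v (x, a, α) = 0) →
        (∀ v ∈ E, ∑ i, ‖(wilsonDirac ρ₃ U m 1).mulVec v i‖ ^ 2 ≤ m₀ ^ 2 / 4 * ∑ i, ‖v i‖ ^ 2) →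
          (Module.finrank ℂ E : ℝ) ≤ C * ((∑ y ∈ Finset.univ.filter
              (fun y : TorusSite 4 L => ∃ z ∈ Z, torusDist y z ≤ R),
            ∑ μ : Fin 4, ∑ ν : Fin 4, (3 - ((ρ₃ (plaquetteHolonomy U y μ ν)).trace).re)) + 1)

/-- **High-block locality** (`U`-uniform quadratic Combes–Thomas at spectral scale `λ`): the resolvent of
`H_U = D_Wᴴ D_W` at `−λ`, `λ ∈ (0, 1]`, has kernel `≤ (C/λ) e^{−c √λ · d(x,y)}` for ALL gauge fields and all
`m ∈ [−1, 1]`, with universal `C, c`. -/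
def HighBlockLocality : Prop :=
  ∃ C c : ℝ, 0 < c ∧ ∀ (L : ℕ) [NeZero L] (U : GaugeConfig 4 L SU3) (m : ℝ), m ∈ Set.Icc (-1 : ℝ) 1 →
    ∀ lam : ℝ, 0 < lam → lam ≤ 1 →
      ∀ (x y : TorusSite 4 L) (a b : Fin 3) (α β : Fin 4),
        ‖((wilsonDirac ρ₃ U m 1)ᴴ * wilsonDirac ρ₃ U m 1 +
            (lam : ℂ) • (1 : Matrix (TorusSite 4 L × Fin 3 × Fin 4) (TorusSite 4 L × Fin 3 × Fin 4) ℂ))⁻¹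
            (x, a, α) (y, b, β)‖ ≤ C / lam * Real.exp (-(c * Real.sqrt lam * torusDist x y))

/-- **Honesty of a regularisation** (= Disproof.lean's `IsTargetReg`, the `∃ reg`-body of the route target X₀
at one `N_f`; VERBATIM the `Honest` of `Lines/geometric-mean-handover.lean` and the hypothesis body of
`GradientFlowSpecies.MassiveLatticeGap` 8922): `HasMassScaling` and, for every positive mass tuple, OS data
along `reg.scheme m z shift` with `IsQCDAlong` and the three non-triviality clauses — the only part of X₀ a
proof can lean on (Disproof §2). [folklore] -/
def Honest {Nf : ℕ} (reg : QCDRegularisation Nf) : Prop :=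
  reg.HasMassScaling ∧ ∀ m : Fin Nf → ℝ, (∀ f, 0 < m f) →
    ∃ (z shift : QCDField Nf → ℕ → ℝ) (T : OSData (QCDField Nf) 4),
      IsQCDAlong (reg.scheme m z shift) T ∧ T.IsNontrivial QCDField.glue ∧
        T.IsNonGaussian QCDField.glue ∧ ∀ f g : Fin Nf, f ≠ g → T.IsNontrivial (QCDField.pseudoRe f g)

/-- **The lattice-gap content at `(reg, m)`** (Disproof §6 `LatticeGapped`; VERBATIM the `LatticeGapped` of
`Lines/geometric-mean-handover.lean`): some `Δ > 0` gaps lattice QCD along the bare trajectory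
`m_f(k) = m_crit(k) + a_k m_f / Z_m(k)`, uniformly in the volume; the clause does not read `z, shift`
(`Negative.hasLatticeMassGap_scheme_indep`). [folklore] -/
def LatticeGapped {Nf : ℕ} (reg : QCDRegularisation Nf) (m : Fin Nf → ℝ) : Prop :=
  ∃ Δ : ℝ, 0 < Δ ∧ (reg.scheme m 0 0).HasLatticeMassGap Δ

/-- **Tempered quarantine gap** — the conclusion of the handover theorem (stub 6): for `N_f = 2, 3`, every
HONEST regularisation and every ratio bound `Rm ≥ 1` there is a threshold `M₁` above which every
`Rm`-TEMPERED mass tuple (`m_f ≤ Rm · m_g` for all `f, g`) has a volume-uniform lattice gap.  Tempered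
because decoupling RAISES the effective pure-gauge scale (`Λ′ = Λ^{1−2N_f/33} ∏_f m_f^{2/33}`,
`CouplingMatching` 8797; one flavour at a time `Λ_{N_f−1} = m_h^{1−r} Λ_{N_f}^r`, `r = b₀(N_f)/b₀(N_f−1) < 1`):
along tempered tuples `Λ′/m_min ≤ Rm^{2N_f/33}(Λ/m_min)^{1−2N_f/33} → 0`, so all quarks ARE heavy at the
handover scale; along hierarchical tuples they need not be (`LightRemnantLatticeGap`). -/
def TemperedQuarantineGap : Prop :=
  ∀ Nf : ℕ, Nf = 2 ∨ Nf = 3 → ∀ reg : QCDRegularisation Nf, Honest reg →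
    ∀ Rm : ℝ, 1 ≤ Rm → ∃ M₁ : ℝ, ∀ m : Fin Nf → ℝ, (∀ f, M₁ < m f) → (∀ f g, m f ≤ Rm * m g) →
      LatticeGapped reg m

/-- **LightRemnantLatticeGap** — the hierarchical tuples (FINDING of the sibling crux-plan seat, VERBATIM
the `LightRemnantLatticeGap` of `Lines/geometric-mean-handover.lean`, so that the two lines SHARE this one
obligation; NOT addressed by the quarantine nor by any card on this crux): for `N_f ∈ {2,3}` and every
honest regularisation there are a ratio bound `Rm ≥ 1` and a threshold `M₂` such that every tuple above
`M₂` with SOME ratio `m_f/m_g > Rm` still has a volume-uniform lattice gap.  Content: along such hierarchies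
the lightest flavours are light relative to the effective scale of the theory with the heavier flavours
decoupled (`N_f = 3`: an `N_f = 2` remnant with scale `Λ₂ = m_h^{2/29} Λ₃^{27/29} → ∞`; `N_f = 2`: an
`N_f = 1` remnant with `Λ₁ = m_h^{2/31} Λ₂^{29/31}`), so for every FIXED threshold the tuple
`(M+1, M+1, m_h → ∞)` eventually carries light remnants: this is the lattice gap of few-LIGHT-flavour
massive QCD, as hard as the summit's gap clause in that regime; filed so that the composition is honest
about what the handover covers. WHY IT MIGHT FAIL: it is the light-quark lattice gap, uniformly in the
volume, with no Yang–Mills reduction available. [cite: JaffeWitten2000, §5] [cite: AppelquistCarazzone1975] -/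
def LightRemnantLatticeGap : Prop :=
  ∀ Nf : ℕ, Nf = 2 ∨ Nf = 3 → ∀ reg : QCDRegularisation Nf, Honest reg →
    ∃ Rm : ℝ, 1 ≤ Rm ∧ ∃ M₂ : ℝ, ∀ m : Fin Nf → ℝ, (∀ f, M₂ < m f) →
      (∃ f g, Rm * m g < m f) → LatticeGapped reg m

/-! ## §2 The seven registered stubs (the only `sorry`s of the line) -/

/-- **stub_gapTransfer — the continuum-half ENGINE** = item `GradientFlowSpecies.GapTransfer`
(stmt-QuantumFields-8923, typed; M–L) BY NAME, shared with `Lines/existence-pays-the-continuum-half.lean`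
(same registered obligation; its docstring there lists the proof route — Lüscher's positive transfer matrix at
fixed `k`, operator bound `‖𝕋ⁿ − P_Ω‖ ≤ e^{−aΔn}`, pass `k → ∞` along `IsQCDAlong`, extend by E0' — and its
three honest gaps G1 `(−1)^F`-twisted torus trace vs vacuum at fixed `k`, G2 order of limits `S → ∞` before
`k → ∞`, G3 norm constants through the transfer-matrix Hilbert space).  USED by §3 at
`sch := reg.scheme m z shift`, `Δ' := Δ/2`.  Vacuum-true, hence not junk-refutable (Disproof §3).  Closes when
8923 closes (same decl), and a proof filed for this stub closes 8923. -/
theorem stub_gapTransfer : Summit.QuantumFields.QCD.Theses.GradientFlowSpecies.GapTransfer := by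
  sorry

/-- **stub_smoothFieldFloor — NO QUARANTINE ON SMALL FIELDS** (unfolded `SmoothFieldFloor`; size M; triage 3:
"add the stub: on small-field domains `N = 0` (coercivity of the block operator), so the cut is only ever
applied inside large-field regions where crude bounds suffice" — this is that stub, so the sharp cut
`σ² = m₀²/4` is never applied where Bałaban's analyticity in the background is needed).
Statement: `∀ m₀ ∈ (0,1] ∃ ε₀ > 0 ∀ L U m`, `m ∈ [−1/2, 1]`, `|m| ≥ m₀`, all plaquette deficits `≤ ε₀` ⟹
`‖D_W(U,m,1) v‖² ≥ (m₀²/2) ‖v‖²` for all `v`.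
Why plausibly true: for `m ∈ [m₀, 1]` it is accretivity (`AccretiveWilsonDirac` 8875: `Re⟨v,D_Wv⟩ ≥ m‖v‖²`,
hence `‖D_Wv‖ ≥ m‖v‖`), with no smallness at all; for `m ∈ [−1/2, −m₀]` the FREE symbol obeys
`H(p) − m² = 2(1+m)W(p) + (W² − Σ_μ u_μ²) ≥ 0` (`u_μ = 1 − cos p_μ`, `W = Σu_μ`; triage 2/3 and the 8872
disprover), so `H ≥ m² ≥ m₀²` for `U ≡ 1` and for every FLAT field (torons: free spectrum at shifted momenta);
for `ε₀`-smooth fields this is a PRINTED THEOREM up to transcription — Neuberger, "Bounds on the Wilson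
Dirac operator", doi:10.1103/physrevd.61.085015 = arXiv:hep-lat/9911004, §"Lower bound", the "general
bound" (read, p. 4–5 of the materialised text): for every gauge background,
`σ_min(D_W(m)) ≥ [1 − (2+√2) Σ_{μ>ν} ε_{μν}]^{1/2} − |1 + m|`, `ε_{μν} = sup_x ‖1 − U_{μν}(x)‖` (operator norm
in colour space), "useful only for `−2 < m < 0`", proved from the explicit formula
`H_W² = m² + 2(m+1)Σ_μ(1 − h_μ) + Σ_{μ≠ν}[(1−h_μ)(1−h_ν) − a_μa_ν − [a_μ,h_ν]]` and the flow inequality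
`|dλ/dm| ≤ 1` (the `m = −1`, `d = 4` case `√(1 − 6(2+√2)η)` is HJL's (2.16) `1 − 30ε` sharpened; tree named
fact `HJLLocality`).  Transcription: for `SU(3)`, `‖1 − U_p‖² = max_j |1 − e^{iθ_j}|² ≤ 2(3 − Re tr U_p)`,
so trace deficit `≤ ε₀` gives `η ≤ √(2ε₀)`; with `√(1−x) ≥ 1 − x`, for `m ∈ [−1/2, −m₀]`:
`σ_min ≥ |m| − 6(2+√2)√(2ε₀) ≥ m₀/√2` as soon as `ε₀ ≤ 10⁻⁴ m₀²` — so `ε₀ ≍ m₀²` (triage 1: `ε₀ = O(m₀²)` is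
FORCED by Landau levels — constant flux `B` puts real modes at `≈ m + B/2`; triage 3: instanton of size `ρ`
lifts its real mode by `≍ ρ⁻²` with core deficit `≍ ρ⁻⁴`).  The 8872 disprover's record concurs: "for each
FIXED `m₀ < 0` a crossing needs some plaquette with `‖1 − U_p‖ ≳ |m₀|`".  Proof route in Lean: vendor
Neuberger's bound as a Literature named fact (or prove it: one page of `h_μ, a_μ` algebra, `h_μ² − a_μ² = 1`,
`[h_μ,a_μ] = 0`, commutators bounded by plaquette deviations — the twin of HJL App. C, which `OverlapLocality`
deliberately left unproved) and derive this statement (deficit → norm conversion, the window arithmetic,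
accretivity for `m > 0`); the torus case is covered (the algebra only uses unitarity of the twisted shifts).
Why it might fail: it should not (printed, any background, any periodic lattice); residual risk = the
transcription of conventions (`wilsonDirac ρ U m 1 = D_w + m` in HJL/Neuberger conventions is recorded in
`OverlapLocality`'s module docstring) and very small tori `L ≤ 2` (wrapping plaquettes; still unitary shifts).
Leans on: tree `wilsonDirac`, `plaquetteHolonomy`, `fundamentalRep`, `l2_opNorm_wilsonDirac_le`,
`entry_norm_bound_of_unitary`; route 8874/8875; Neuberger hep-lat/9911004; HJL `HernandezJansenLuscher1999`
(2.16) + App. C; Adams doi:10.1103/physrevd.68.065009; Kerler (flow inequality). -/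
theorem stub_smoothFieldFloor :
    ∀ m₀ : ℝ, 0 < m₀ → m₀ ≤ 1 → ∃ ε₀ : ℝ, 0 < ε₀ ∧
      ∀ (L : ℕ) [NeZero L] (U : GaugeConfig 4 L (Matrix.specialUnitaryGroup (Fin 3) ℂ)) (m : ℝ),
        m ∈ Set.Icc (-(1 / 2 : ℝ)) 1 → m₀ ≤ |m| →
        (∀ (y : TorusSite 4 L) (μ ν : Fin 4),
          3 - ((fundamentalRep (Fin 3) (plaquetteHolonomy U y μ ν)).trace).re ≤ ε₀) →
          ∀ v : TorusSite 4 L × Fin 3 × Fin 4 → ℂ,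
            m₀ ^ 2 / 2 * ∑ i, ‖v i‖ ^ 2 ≤
              ∑ i, ‖(wilsonDirac (fundamentalRep (Fin 3)) U m 1).mulVec v i‖ ^ 2 := by
  sorry

/-- **stub_lowModesHugRoughness — LOW MODES HUG THE ROUGHNESS** (the card's FIRST LEMMA, unfolded
`LowModesHugRoughness`; size L; lattice Agmon / Combes–Thomas below a LOCAL spectral floor).
Statement: `∀ m₀ ∈ (0,1] ∃ ε₀ c C > 0 ∀ L U m`, `m ∈ [−1/2,1]`, `|m| ≥ m₀`, every eigenvector
`H_U v = e v` of `H_U = D_Wᴴ D_W` with `0 ≤ e ≤ m₀²/4`, every site `x` at torus distance `≥ n` from EVERY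
`ε₀`-rough plaquette (`3 − Re tr U_p ≥ ε₀`): `Σ_{a,α} |v(x,a,α)|² ≤ C e^{−cn} ‖v‖²`.
Sharpenings from triage, recorded as part of the obligation's reading: (1) `e : ℝ` with `0 ≤ e` explicit
(triage 2); (2) `ε₀ = O(m₀²)` is FORCED (triage 1 (iii): constant abelian flux `B` makes Landau would-be zero
modes REAL modes at `≈ m + B/2`, sub-threshold iff `B ≥ m₀`, i.e. deficit `≳ m₀²` — so smaller fluxes must
count as smooth and produce no sub-threshold modes, which is `stub_smoothFieldFloor`); (3) the rate degrades
like `c ∝ m₀` (band curvature `1 + m`); (4) the NO-ROUGH-PLAQUETTE case is explicit (triage 3): then the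
distance hypothesis holds for every `n`, the bound forces `v = 0`, i.e. "no eigenvalue `≤ m₀²/4` at all" —
consistent with, and on large tori implied by, `stub_smoothFieldFloor` (floor `m₀²/2 > m₀²/4`).
Why plausibly true (triage 1 (ii) made the exactly-flat case a THEOREM: for `v` supported at distance `≥ 1`
from the rough links `‖D_W v‖ = ‖D_free v‖ ≥ |m|‖v‖`, so the Dirichlet restriction of `H` to the flat region
is `≥ m₀² ≥ e + 3m₀²/4` ⇒ exponential decay): in general, IMS-localise `stub_smoothFieldFloor` on balls of
radius `R ≍ 1/m₀` inside the smooth region (error `O(R⁻²) ≤ m₀²/8`), get a local floor `≥ 3m₀²/8 ≥ e + m₀²/8`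
off the `R`-collar of the rough set, and run the Combes–Thomas conjugation `e^{c·dist(·,Rough)}` at spectral
distance `m₀²/8` (abstract conjugation lemma: `RenormalisedVafaWitten.AccretiveCombesThomas` 8696; standard
lattice eigenfunction decay as in Aizenman–Warzel GSM 168 doi:10.1090/gsm/168, Combes–Thomas
doi:10.1007/bf01646473).  No delocalised sub-threshold mode was found by three triagers (torons, weak flux,
fat instantons all covered by the `∃ ε₀(m₀)` order).  Cheapest falsifier: kit toy (6⁴–8⁴ torus, Haar-random
2⁴ nest in an identity sea, `m ∈ {+0.4, −0.4, −0.25}`, lowest eigenpairs of `H`, mass fraction on the nest and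
fitted decay rate) — jobs j008764 (ideator), j009468 / j009800 (triage) queued at plan time, results attach to
the crux item; Lüscher's local coherence of low modes doi:10.1088/1126-6708/2007/07/081 is the print-level
face.  Leans on: tree `wilsonDirac`, `plaquetteHolonomy`, `torusDist`; `stub_smoothFieldFloor`; 8696; 8874. -/
theorem stub_lowModesHugRoughness :
    ∀ m₀ : ℝ, 0 < m₀ → m₀ ≤ 1 → ∃ ε₀ c C : ℝ, 0 < ε₀ ∧ 0 < c ∧ 0 < C ∧
      ∀ (L : ℕ) [NeZero L] (U : GaugeConfig 4 L (Matrix.specialUnitaryGroup (Fin 3) ℂ)) (m : ℝ),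
        m ∈ Set.Icc (-(1 / 2 : ℝ)) 1 → m₀ ≤ |m| →
        ∀ (v : TorusSite 4 L × Fin 3 × Fin 4 → ℂ) (e : ℝ), 0 ≤ e → e ≤ m₀ ^ 2 / 4 →
          ((wilsonDirac (fundamentalRep (Fin 3)) U m 1)ᴴ *
              wilsonDirac (fundamentalRep (Fin 3)) U m 1).mulVec v = (e : ℂ) • v →
            ∀ (x : TorusSite 4 L) (n : ℕ),
              (∀ y : TorusSite 4 L,
                (∃ μ ν : Fin 4, ε₀ ≤ 3 - ((fundamentalRep (Fin 3) (plaquetteHolonomy U y μ ν)).trace).re) →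
                  n ≤ torusDist x y) →
              ∑ a : Fin 3, ∑ α : Fin 4, ‖v (x, a, α)‖ ^ 2 ≤
                C * Real.exp (-(c * n)) * ∑ i, ‖v i‖ ^ 2 := by
  sorry

/-- **stub_localModeBudget — THE QUARANTINE'S RANK IS PAID BY LOCAL ACTION** (unfolded `LocalModeBudget`;
size L; the LOCAL, volume-free form of route crux 3 `ActionBoundsLowModes` (8872) BELOW the free threshold —
triage 1: "the natural sharpening `N ≤ C_{m₀}(S_W + 1)` below `m₀²/4` is the budget the handover actually
wants (volume-free) — file it as the support"; gen-2 card band-limited-payload: "LocalModeBudget — the LOCAL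
form of 8872" — here in Dirichlet (support) form, which is linear in `E` and is what an IMS-localised
consumer needs).  Statement: `∀ m₀ ∈ (0,1] ∃ R C ∀ L U m`, `m ∈ [−1/2,1]`, `|m| ≥ m₀`, every site set `Z`
and every subspace `E` of quark fields SUPPORTED IN `Z` on which `‖D_W v‖² ≤ (m₀²/4)‖v‖²`:
`dim E ≤ C · (Σ_{y : dist(y,Z) ≤ R} Σ_{μ,ν} (3 − Re tr U_p(y,μ,ν)) + 1)`.
Why plausibly true: below the free gap (`m₀²/4 < m₀² ≤ m²`) there is NO WEYL TERM — for `U ≡ 1` (and every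
flat field) `‖D_W v‖² ≥ m²‖v‖²` for every `v` whatever its support, so `E = 0`; a single site supports
nothing (`‖D_W v‖² = ((m+4)² + 4)‖v‖²`); sub-threshold modes need ROUGHNESS within range: by
`stub_smoothFieldFloor` IMS-localised (hence the collar `R ≍ 1/m₀`), if all plaquettes within `R` of `Z` are
`ε₀`-smooth then `E = 0`, else the collar action is `≥ ε₀ ≍ m₀²`.  Linearity in the action in both extremes:
(Landau) constant flux `B` produces sub-threshold real modes only for `B ≳ m₀` (triage 1 (iii)), and then
`#modes/|Z| ≈ B/2π` against action density `≍ B²`, ratio `≤ C/m₀`; (maximal roughness) `dim E ≤ 12|Z|` against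
action `≍ |Z|`.  The 8872 disprover: "in `d = 4` there is no weak-coupling binding — a field of strength `δ` on a
region of radius `R` has Birman–Schwinger norm `~ δR²` at the threshold, so a mid-gap state needs `δR² ≳ 1`,
i.e. action `δ²R⁴ ≳ 1`"; its landed `Negative.LoadBearing` (`+1` needed at `m = 0, λ = 0`; Weyl term needed at
`λ = 81`) lies outside this regime (`|m| ≥ m₀`, `λ = m₀²/4`), and the `+1` is kept anyway.  Proof route: as for
8872 (lattice Lichnerowicz 8874 + Kato domination + discrete magnetic CLR, Rozenblum–Solomyak
doi:10.1007/s10958-009-9436-9) but RELATIVE to the floor `m₀²/2` of `stub_smoothFieldFloor`, so that only the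
collar's curvature enters (Birman–Schwinger at threshold `−m₀²/4` relative to the smooth-field operator).
Why it might fail: a family of rough collars carrying super-linearly many Dirichlet sub-threshold modes per
unit action at FIXED `m₀` (none known: Vafa–Witten flux counting, EHN spectral flow hep-lat/9802016, BNN
hep-lat/0006030 all linear); constants blow up as `m₀ → 0` (irrelevant at the handover, `m₀ = O(1)`).
Cheapest falsifier: the gen-2 card's kit recipe (8⁴, flux `n = 1…12`, Haar nests, one lump; count Dirichlet
modes in `Z` below `m₀²/4` vs collar action).  Leans on: tree `wilsonDirac`, `wilsonAction`-type deficits,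
`torusDist`, `Module.finrank`; route 8872/8874; VafaWitten1984CMP. -/
theorem stub_localModeBudget :
    ∀ m₀ : ℝ, 0 < m₀ → m₀ ≤ 1 → ∃ (R : ℕ) (C : ℝ),
      ∀ (L : ℕ) [NeZero L] (U : GaugeConfig 4 L (Matrix.specialUnitaryGroup (Fin 3) ℂ)) (m : ℝ),
        m ∈ Set.Icc (-(1 / 2 : ℝ)) 1 → m₀ ≤ |m| →
        ∀ (Z : Finset (TorusSite 4 L)) (E : Submodule ℂ (TorusSite 4 L × Fin 3 × Fin 4 → ℂ)),
          (∀ v ∈ E, ∀ x ∉ Z, ∀ (a : Fin 3) (α : Fin 4), v (x, a, α) = 0) →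
          (∀ v ∈ E, ∑ i, ‖(wilsonDirac (fundamentalRep (Fin 3)) U m 1).mulVec v i‖ ^ 2 ≤
              m₀ ^ 2 / 4 * ∑ i, ‖v i‖ ^ 2) →
            (Module.finrank ℂ E : ℝ) ≤ C * ((∑ y ∈ Finset.univ.filter
                (fun y : TorusSite 4 L => ∃ z ∈ Z, torusDist y z ≤ R),
              ∑ μ : Fin 4, ∑ ν : Fin 4,
                (3 - ((fundamentalRep (Fin 3) (plaquetteHolonomy U y μ ν)).trace).re)) + 1) := by
  sorry

/-- **stub_highBlockLocality — THE COERCIVE BLOCK IS QUASI-LOCAL UNIFORMLY IN THE FIELD** (unfolded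
`HighBlockLocality`; size M; the card's "smooth-functional-calculus locality" stub in its generating case, the
RESOLVENT at spectral scale `λ`: every Stieltjes / contour functional calculus of the high block —
`D_high⁻¹ = Dᴴ f(DDᴴ)`, `tr log` of the high block, the smooth singular-value cut-offs — is an integral of
these resolvents).  Statement: universal `C, c > 0` with
`|(D_Wᴴ D_W + λ)⁻¹((x,a,α),(y,b,β))| ≤ (C/λ) exp(−c √λ · torusDist x y)` for all `L`, ALL `SU(3)` fields `U`,
`m ∈ [−1,1]`, `λ ∈ (0,1]`.
Why plausibly true (in fact a proof sketch): QUADRATIC Combes–Thomas — conjugate `D = D_W` (range 1 in the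
torus `ℓ^∞` metric) by `e^{φ}`, `φ = θ·torusDist(·,y)`: `D_{±φ} = D + E_±` with `‖E_±‖ ≤ h(e^θ − 1) =: η`
(Schur test; `h ≤ 8` hops of norm `≤ 1`, `‖D_W‖ ≤ |m+4| + 4 ≤ 9` by the tree's `l2_opNorm_wilsonDirac_le`);
`e^{φ}(DᴴD + λ)e^{−φ} = (D_{−φ})ᴴ D_φ + λ` and `Re⟨v, ((D+E_−)ᴴ(D+E_+) + λ)v⟩ ≥ ‖Dv‖² − 2η‖Dv‖‖v‖ − η²‖v‖² +
λ‖v‖² ≥ (λ − 2η²)‖v‖²`; choose `η = √λ/2` (`θ ≍ √λ`): the conjugated operator is `λ/2`-accretive, its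
inverse has norm `≤ 2/λ`, and undoing the conjugation gives the kernel bound with rate `θ ≍ √λ` — NO spectral
information on `U` is used, which is the point (the high block is coercive by construction, the low block
has been quarantined).  The same rate comes from Chebyshev approximation of `1/(s+λ)` on `[0, 81]`
(degree-`n` error `≍ e^{−2n√(λ/81)}`, `Hⁿ` has range `2n`; HJL (2.11)–(2.12) machinery of `OverlapLocality`).
Why it might fail: it cannot as a statement (both proofs are standard); the risk is only Lean plumbing
(matrix inverse as `Matrix.inv`, junk-free since `H + λ` is positive definite).  Leans on: tree `wilsonDirac`,
`torusDist`, `l2_opNorm_wilsonDirac_le`, `sum_norm_sq_mulVec_le`; 8696 `AccretiveCombesThomas` (the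
accretive twin); `DaviesGaffneyWilson` 8873 (the semigroup twin).  Sources: Combes–Thomas
doi:10.1007/bf01646473; HernandezJansenLuscher1999 (2.12); Aizenman–Warzel doi:10.1090/gsm/168 Ch. 10. -/
theorem stub_highBlockLocality :
    ∃ C c : ℝ, 0 < c ∧
      ∀ (L : ℕ) [NeZero L] (U : GaugeConfig 4 L (Matrix.specialUnitaryGroup (Fin 3) ℂ)) (m : ℝ),
        m ∈ Set.Icc (-1 : ℝ) 1 → ∀ lam : ℝ, 0 < lam → lam ≤ 1 →
          ∀ (x y : TorusSite 4 L) (a b : Fin 3) (α β : Fin 4),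
            ‖((wilsonDirac (fundamentalRep (Fin 3)) U m 1)ᴴ * wilsonDirac (fundamentalRep (Fin 3)) U m 1 +
                (lam : ℂ) • (1 : Matrix (TorusSite 4 L × Fin 3 × Fin 4) (TorusSite 4 L × Fin 3 × Fin 4) ℂ))⁻¹
                (x, a, α) (y, b, β)‖ ≤
              C / lam * Real.exp (-(c * Real.sqrt lam * torusDist x y)) := by
  sorry

/-- **stub_quarantinedDecoupling — THE HANDOVER THEOREM (HARDEST; open / XL)**: the four spectral facts
imply `TemperedQuarantineGap` — for `N_f = 2, 3`, every X₀-HONEST regularisation `reg` (hypothesis = the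
`∃ reg`-body of `ContinuumQCDExists`, INCLUDING the three non-triviality clauses — Disproof §2 honoured
here) and every ratio bound `Rm ≥ 1`, there is a threshold `M₁` such that for every `Rm`-tempered mass tuple
above `M₁` lattice QCD at `β_k` and the honest bare masses `m_crit(k) + a_k m_f/Z_m(k)` has a volume-uniform
lattice gap `∃ Δ > 0, (reg.scheme m 0 0).HasLatticeMassGap Δ` (with `stub_lightRemnantLatticeGap` this is
`GradientFlowSpecies.MassiveLatticeGap` 8922, §3 `massiveLatticeGap_of_quarantine`).
MECHANISM (card + triage; every step at the BLOCK scale, never at the fine lattice — Disproof §9(ii),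
FINDINGS dead end "terminal quarantine at the fine lattice"):
(1) FLOW to the handover scale: along `reg`'s honest bare data run the interleaved gauge/fermion block flow
    (route crux `InterleavedHeatSliceFlow` 8891, UNPROVED — its burden, not re-registered here) down to an
    asymptotically free block scale `ℓ₀` with `ℓ₀ M ≍ K` large, so that the block-effective Dirac operator
    `D` has `|m_eff| ≥ m₀ = O(1)` in block units and the pure-gauge remainder is matched to Wilson YM at
    `β_eff` (`CouplingMatching` 8797; the marginal `log` of Disproof §9(i)) plus an irrelevant remainder
    two-sided `≤ C(ℓ₀M)⁻²` on small-field blocks (card threshold-irrelevance-squeeze; the FREE threshold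
    `M → ∞` makes it smaller than any coupling-relative radius).
(2) QUARANTINE at `λ = m₀²/4`: the terminal Berezin integral factorises EXACTLY across the singular-value
    cut (§0 `intertwine_pow`, `cross_terms_vanish`); transported to `D` (the four hypotheses are the
    `wilsonDirac` model case, whose proofs are background-generic): `h₁` ⇒ the low block is EMPTY on
    small-field regions (no non-analytic cut where Bałaban analyticity is needed — triage 3); `h₂` ⇒ the low
    modes and the projector `P_low` are supported on the `R`-collars of large-field regions up to
    `e^{−c·dist}` tails; `h₃` ⇒ per large-field region `X` the rank is `N_X ≤ C(m₀)(s_W(X⁺) + 1)`, paid by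
    Bałaban's `e^{−p(g_j)²|X|}` / Wilson's `e^{−β_k s_W}` with unbounded slack (band-limited-payload's
    accounting: `O(1)` per block per mode); `h₄` ⇒ the high block's covariance `D_high⁻¹ = Dᴴ f(DDᴴ)` and
    `tr log` are quasi-local uniformly in the field (Stieltjes integrals of resolvents at scale `λ`), so the
    bulk is a gauge-invariant quasi-local block-scale perturbation; `|det D_low| = ∏σ_i ≤ λ^{N/2} ≤ 1`,
    adjugates `≤ λ^{(N−1)/2}` (Hadamard): the large-field fermionic factor has modulus `≤ 1` (floor `0`,
    `BlockScaleEffectivePerturbation.hasLargeFieldFloor_of_nonneg`) and carries the WHOLE sign of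
    `∏_f det D_W(m_f(k))` (`N_f = 3`, split `N_f = 2`: barrier `WilsonDeterminantSign`'s own identity
    `sign det = (−1)^{#real modes}` read blockwise, γ₅-hermiticity `wilsonDirac_gammaFive_hermitian`).
(3) GAP from the format: block weight = (positive, Kotecký–Preiss-controlled bulk around Wilson YM at
    `β_eff(ℓ₀)`) × `∏_X` (signed factors of modulus `≤ 1` on large-field polymers, abundant per correlation
    volume but individually suppressed with slack) ⇒ convergent cluster expansion for `log Z` and for the
    connected correlations of all gauge-invariant local lattice observables (quark-carrying channels through
    the heavy quark-line representation with `D_high⁻¹` local and `D_low` finite), uniformly in `S ≥ L_k`,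
    eventually in `k` ⇒ `HasLatticeMassGap Δ(m)`; `Z_{k,S} ≠ 0` comes with convergence.  THIS STEP CONTAINS
    THE YANG–MILLS INPUT every line on this crux needs and no printed theorem supplies: an EXPANSION-FORMAT
    (polymer-gas / complete-analyticity-strength) control of pure `SU(3)` lattice Yang–Mills at the a.f.
    block scale `ℓ₀`, β-UNIVERSAL along the matched sequences `β_eff(·; m)` (FINDINGS B2: one
    mass-independent `reg` sweeps an interval of couplings, so 8796-type universality is NECESSARY; B1: pair
    clustering / a transfer-matrix gap is KP-useless, tree decay is a format input; B4: state it at an a.f.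
    scale), i.e. `HeavyThresholdYMBridge`'s named condition in its RG-level form (`RobustYangMillsRG`, to be
    typed over D1′ with SIGNED large-field histories — the typed shadow `RobustYangMills` 13897 is a sup-small
    FINE-lattice cone and D1′ `HasBlockScaleEffectivePerturbation` has positive weights, so neither can be
    cited by name for the quarantined format; see the line card's RESHAPE OPTION).
WHY IT MIGHT FAIL: it contains the weak-coupling `SU(3)` lattice Yang–Mills gap in β- and format-universal
form (open; barrier `PerturbativeInvisibility`: invisible to any expansion in `g`); large-field polymers are
ABUNDANT per correlation volume at an a.f. handover scale (`(ξ/ℓ₀)⁴ e^{−p(g(ℓ₀))²} ≫ 1`, triage 2 / FINDINGS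
B3), so the reference's polymer representation at scale `ξ`, not mere mixing, must absorb them; the phase of
`det D_high` (complex in general) must be tracked through the bulk expansion (`e^{tr log D_high}` quasi-local
by `h₄`, oscillating but controlled — card's honest residue); an honest calibration parked in an exotic Wilson
phase for infinitely many `k` must be absorbed by the threshold (it can: `M` is existential per `reg`, finger
widths `≪ a_k M/Z_m` eventually — triage 2).  NOT refutable by junk: 8922's hypothesis excludes `canonicalAF`
/ `z = 0` (Disproof §2–§3), its threshold is per `reg` (absorbs down-shifted `m_crit`, triage 2 θ-side check).
Uses `h₁` at step (2) small fields, `h₂`+`h₃` at step (2) large fields, `h₄` at steps (2)–(3) bulk locality.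
Sources: Balaban1988Convergent, Balaban1989LargeFieldII, BalabanOcarrollSchor1989, Seiler1982 Ch. 3 (cluster
expansions with signed fermionic activities), KoteckyPreiss1986, DobrushinShlosman1987, Dimock arXiv:2204.07201
§3, Duncan–Eichten–Thacker doi:10.1103/physrevd.59.014505 (truncated determinant: the algorithmic precedent
of the split), Lüscher doi:10.1088/1126-6708/2007/07/081, JaffeWitten2000 §5. -/
theorem stub_quarantinedDecoupling :
    SmoothFieldFloor → LowModesHugRoughness → LocalModeBudget → HighBlockLocality →
      TemperedQuarantineGap := by
  sorry

/-- **stub_lightRemnantLatticeGap — THE HIERARCHICAL CORNER (open; NOT this line's mechanism)** =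
`LightRemnantLatticeGap` above, VERBATIM the registered stub `stub_LightRemnantLatticeGap` of the sibling
line `Lines/geometric-mean-handover.lean` (one obligation shared by two lines; whichever proves it closes it
for both).  Recorded here because the quarantine's handover, like every heavy-quark handover, needs ALL
quarks heavy at the handover scale, which tempering guarantees and a bare threshold does not (decoupling
raises the effective scale).  Size: open-problem (few-light-flavour massive lattice QCD gap); a prover should
NOT start here. [cite: JaffeWitten2000, §5] [cite: AppelquistCarazzone1975] -/
theorem stub_lightRemnantLatticeGap : LightRemnantLatticeGap := by
  sorry

/-! ## §3 The composition (sorry-free): the seven stubs ⇒ the crux BY NAME -/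

/-- **The lattice half, per-regularisation threshold form** from the tempered handover and the hierarchical
remnant (pure logic; order of choices: `Rm, M₂` from the remnant → `M₁` from the handover at that `Rm` →
threshold `max (max M₁ M₂) 0`; tempered tuples go through the quarantine, the others through the remnant). [folklore] -/
theorem latticeGapped_aboveThreshold (hT : TemperedQuarantineGap) (hL : LightRemnantLatticeGap) {Nf : ℕ}
    (hNf : Nf = 2 ∨ Nf = 3) (reg : QCDRegularisation Nf) (hreg : Honest reg) :
    ∃ M : ℝ, 0 ≤ M ∧ ∀ m : Fin Nf → ℝ, (∀ f, M < m f) → LatticeGapped reg m := by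
  obtain ⟨Rm, hRm, M₂, hL'⟩ := hL Nf hNf reg hreg
  obtain ⟨M₁, hT'⟩ := hT Nf hNf reg hreg Rm hRm
  refine ⟨max (max M₁ M₂) 0, le_max_right _ _, fun m hm => ?_⟩
  have hm1 : ∀ f, M₁ < m f := fun f =>
    lt_of_le_of_lt ((le_max_left M₁ M₂).trans (le_max_left _ _)) (hm f)
  have hm2 : ∀ f, M₂ < m f := fun f =>
    lt_of_le_of_lt ((le_max_right M₁ M₂).trans (le_max_left _ _)) (hm f)
  by_cases htemp : ∀ f g, m f ≤ Rm * m g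
  · exact hT' m hm1 htemp
  · simp only [not_forall, not_le] at htemp
    obtain ⟨f, g, hfg⟩ := htemp
    exact hL' m hm2 ⟨f, g, hfg⟩

/-- The lattice-half residual `GradientFlowSpecies.MassiveLatticeGap` (8922) BY NAME from this line: stubs 2–5
feed stub 6 (their unfolded statements are the bodies of the §1 definitions, definitionally), stub 7 covers
the hierarchical corner; 8922's hypothesis body is `Honest reg` and its conclusion `LatticeGapped` verbatim. [folklore] -/
theorem massiveLatticeGap_of_quarantine :
    Summit.QuantumFields.QCD.Theses.GradientFlowSpecies.MassiveLatticeGap := by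
  intro Nf hNf reg hreg
  obtain ⟨M, -, hM⟩ := latticeGapped_aboveThreshold
    (stub_quarantinedDecoupling stub_smoothFieldFloor stub_lowModesHugRoughness stub_localModeBudget
      stub_highBlockLocality) stub_lightRemnantLatticeGap hNf reg hreg
  exact ⟨M, hM⟩

/-- **The common head of every line on this crux** (re-derivation of
`Lines/existence-pays-the-continuum-half.lean`'s `handover_of_gapTransfer_of_massiveLatticeGap` over the
LANDED `Negative.GapClauses` lemmas): `GapTransfer (8923) → MassiveLatticeGap (8922) → (ContinuumQCDExists →
QCD)`.  Logic: fix `N_f ∈ {2,3}`; X₀ gives `reg` with `HasMassScaling` and the honest body `hb`; 8922 at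
`(reg, hb)` gives the threshold `M`; by the landed `qcdOf_iff_threshold` it suffices to produce the
`QCDOf`-body above `M₀ := max M 0` for THIS `reg`; for such `m`, X₀ supplies `(z, shift, T)` (non-triviality
clauses passed on verbatim — Disproof §2), 8922 supplies `Δ > 0` with the lattice gap of `reg.scheme m 0 0`,
transported to `reg.scheme m z shift` by `hasLatticeMassGap_scheme_indep` (`Iff.rfl`); 8923 turns it into
`T.HasMassGap (Δ/2)`; `hasLatticeMassGap_anti` puts the lattice clause at `Δ/2` too. [folklore] -/
theorem handover_of_gapTransfer_of_massiveLatticeGap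
    (hGT : Summit.QuantumFields.QCD.Theses.GradientFlowSpecies.GapTransfer)
    (hML : Summit.QuantumFields.QCD.Theses.GradientFlowSpecies.MassiveLatticeGap) :
    ContinuumQCDExists → _root_.QCD := by
  intro hX
  have key : ∀ Nf : ℕ, (Nf = 2 ∨ Nf = 3) → QCDOf Nf := by
    intro Nf hNf
    obtain ⟨reg, hms, hb⟩ := hX Nf hNf
    obtain ⟨M, hM⟩ := hML Nf hNf reg ⟨hms, hb⟩
    refine (qcdOf_iff_threshold Nf).mpr ⟨max M 0, le_max_right _ _, reg, hms, fun m hm => ?_⟩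
    have hm0 : ∀ f, 0 < m f := fun f => lt_of_le_of_lt (le_max_right M 0) (hm f)
    have hmM : ∀ f, M < m f := fun f => lt_of_le_of_lt (le_max_left M 0) (hm f)
    obtain ⟨z, shift, T, hA, hN, hG, hP⟩ := hb m hm0
    obtain ⟨Δ, hΔ, hL⟩ := hM m hmM
    have hL' : (reg.scheme m z shift).HasLatticeMassGap Δ :=
      (hasLatticeMassGap_scheme_indep reg m 0 0 z shift Δ).mp hL
    refine ⟨z, shift, T, hA, hN, hG, hP, Δ / 2, half_pos hΔ, ?_, ?_⟩
    · exact hGT Nf (reg.scheme m z shift) T Δ (Δ / 2) (half_pos hΔ) (half_lt_self hΔ) hA hL'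
    · exact hasLatticeMassGap_anti _ (half_le_self hΔ.le) hL'
  exact ⟨key 2 (Or.inl rfl), key 3 (Or.inr rfl)⟩

/-- **RobustYangMillsHandover_of — the line closes the crux modulo exactly the seven registered stubs.**
(`RobustYangMillsHandover` unfolds to `ContinuumQCDExists → QCD`; the conclusion is the route decl BY NAME;
no hypotheses.) -/
theorem RobustYangMillsHandover_of :
    Summit.QuantumFields.QCD.Theses.HeatSlicedQuarks.RobustYangMillsHandover :=
  handover_of_gapTransfer_of_massiveLatticeGap stub_gapTransfer massiveLatticeGap_of_quarantine

/-! ## §4 Sanity links (sorry-free, not registered) -/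

/-- The packaged names are the unfolded stub texts (definitional; recorded so the lead sees that stubs 2–5
are exactly the hypotheses of stub 6). [folklore] -/
theorem packaged_iff :
    (SmoothFieldFloor ↔
      ∀ m₀ : ℝ, 0 < m₀ → m₀ ≤ 1 → ∃ ε₀ : ℝ, 0 < ε₀ ∧
        ∀ (L : ℕ) [NeZero L] (U : GaugeConfig 4 L (Matrix.specialUnitaryGroup (Fin 3) ℂ)) (m : ℝ),
          m ∈ Set.Icc (-(1 / 2 : ℝ)) 1 → m₀ ≤ |m| →
          (∀ (y : TorusSite 4 L) (μ ν : Fin 4),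
            3 - ((fundamentalRep (Fin 3) (plaquetteHolonomy U y μ ν)).trace).re ≤ ε₀) →
            ∀ v : TorusSite 4 L × Fin 3 × Fin 4 → ℂ,
              m₀ ^ 2 / 2 * ∑ i, ‖v i‖ ^ 2 ≤
                ∑ i, ‖(wilsonDirac (fundamentalRep (Fin 3)) U m 1).mulVec v i‖ ^ 2) ∧
    (HighBlockLocality ↔
      ∃ C c : ℝ, 0 < c ∧
        ∀ (L : ℕ) [NeZero L] (U : GaugeConfig 4 L (Matrix.specialUnitaryGroup (Fin 3) ℂ)) (m : ℝ),
          m ∈ Set.Icc (-1 : ℝ) 1 → ∀ lam : ℝ, 0 < lam → lam ≤ 1 →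
            ∀ (x y : TorusSite 4 L) (a b : Fin 3) (α β : Fin 4),
              ‖((wilsonDirac (fundamentalRep (Fin 3)) U m 1)ᴴ * wilsonDirac (fundamentalRep (Fin 3)) U m 1 +
                  (lam : ℂ) • (1 : Matrix (TorusSite 4 L × Fin 3 × Fin 4)
                    (TorusSite 4 L × Fin 3 × Fin 4) ℂ))⁻¹ (x, a, α) (y, b, β)‖ ≤
                C / lam * Real.exp (-(c * Real.sqrt lam * torusDist x y))) :=
  ⟨Iff.rfl, Iff.rfl⟩

/-- Sanity link: the crux IS the arrow §3 concludes. [folklore] -/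
theorem robustYangMillsHandover_iff :
    Summit.QuantumFields.QCD.Theses.HeatSlicedQuarks.RobustYangMillsHandover ↔
      (ContinuumQCDExists → _root_.QCD) :=
  Iff.rfl

end Summit.QuantumFields.QCD.Cruxes.RobustYangMillsHandover.LowModeQuarantine

end
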